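import Mathlib
import HarnessLib
import Summits.Ventures.LatticeQCDFlow.Scaling.AutoregressiveProposalAcceptance

/-!
# LatticeQCDFlow / Scaling — the acceptance form, INSTANCES: every proposal density bounded away from
# `0` and `∞` (its own conditional), every autoregressive product (its conditional at `a`)

HONEST FRAMING: exact (Metropolis-corrected) sampling algorithms for lattice gauge theory;
figures of merit are autocorrelation/cost numbers at stated couplings and volumes; no
continuum-physics claim.

Venture `LatticeQCDFlow` (cell pub-lqcd), topic `Scaling`, FANOUT row 30 (lean-1, GEN-19) — OUR WORK,
companion of `Scaling/AutoregressiveProposalAcceptance` (`meanAccept_le_of_condProposal`: an exact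
independence-Metropolis sampler with target `F/Z` and proposal density `Q` whose conditional at the
coordinate `a` given the context off `insert a s` is `q` accepts in equilibrium at most
`1 − (1/(4Z))∫|A_s F − q·A_{insert a s} F| dπ`).  Here the structural hypothesis
`A_s Q = q·A_{insert a s} Q`, `q ≥ 0` bounded measurable normalised in `a`, is discharged:

* §1 `coordAvg_insert_eq_integral_coordAvg_update` — **the tower the other way round**,
  `A_{insert a s} h (ω) = ∫ A_s h (ω[a ↦ v]) dμ(v)` (`a ∉ s`; the tree's `coordAvg_insert_of_bounded`
  is `A_{insert a s} = A_s ∘ A_a`).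
* §2 `blind_mono`; (a) `condProposal_props` — for measurable `Q` with `0 < c ≤ Q ≤ C` (every
  normalising-flow density on a compact group) the OWN CONDITIONAL `q = A_s Q / A_{insert a s} Q` is
  measurable,
  `0 ≤ q ≤ C/c`, normalised in `a`, and `A_s Q = q·A_{insert a s} Q`;
  (b) `coordAvg_arProduct` — for an AUTOREGRESSIVE PRODUCT `Q = R·q·T` (`R` = the conditionals of the
  coordinates generated before `a`, blind to `insert a s`; `q` = the conditional at `a`, blind to `s`,
  normalised in `a`; `T` = the later conditionals, `A_s T = 1`): `A_s Q = R·q`, `A_{insert a s} Q = R`.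
* §3 the packaged acceptance ceilings **`meanAccept_le_of_pos_proposal`** and
  **`meanAccept_le_of_arProduct`**: `ā ≤ 1 − (1/(4Z))∫|A_s F − q·A_{insert a s} F| dπ` — THE
  CONDITIONAL USED AT ONE COORDINATE ALONE CAPS THE EQUILIBRIUM ACCEPTANCE OF THE EXACT SAMPLER,
  whatever the rest of the architecture does.

READING (value-free): combine with the cell's floors for conditioners blind at one endpoint of a gauge
link (`∫|A_sF − q·A_{insert a s}F| ≥ ∫|A_sF − A_{insert a s}F| ≥ Z·⟨(1/N)Re tr U_p⟩_β`, every volume):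
such a sampler rejects at least `⟨W₁ₓ₁⟩_β/4` of its proposals at every volume (typed separately once
those parents are built).  NOT CLAIMED: unbounded densities; the sharp constant.  No `def`, no `sorry`,
nothing cited as a fact.
-/

noncomputable section

namespace Summit.Ventures.LatticeQCDFlow.Theory2.Autoregressive

open MeasureTheory Function Set
open Summit.Ventures.LatticeQCDFlow.Exactness

variable {ι : Type*} [Fintype ι] [DecidableEq ι] {X : Type*} [MeasurableSpace X]
variable (μ : Measure X) [IsProbabilityMeasure μ]

/-! ## §1 The reversed tower -/

/-- **The tower the other way round, `A_{insert a s} = A_a ∘ A_s`** (`a ∉ s`, bounded measurable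
`h`): `A_{insert a s} h (ω) = ∫ A_s h (ω[a ↦ v]) dμ(v)`.  Redraw the `a`-coordinate of the integrated
sample first (tree `integral_pi_eq_integral_integral_update'`), then Fubini. [ours] -/
theorem coordAvg_insert_eq_integral_coordAvg_update {a : ι} {s : Finset ι} (ha : a ∉ s)
    {h : (ι → X) → ℝ} (hm : Measurable h) {C : ℝ} (hb : ∀ ω, |h ω| ≤ C) (ω : ι → X) :
    coordAvg μ (insert a s) h ω = ∫ v, coordAvg μ s h (update ω a v) ∂μ := by
  have huniv : (fun _ : ι => μ) a Set.univ ≠ 0 := by simp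
  have hint1 : Integrable (fun ω' : ι → X => h ((insert a s).piecewise ω' ω))
      (Measure.pi fun _ : ι => μ) := integrable_section_of_abs_le μ (insert a s) hm hb ω
  have hglue : ∀ (ω' : ι → X) (v : X),
      (insert a s).piecewise (update ω' a v) ω = s.piecewise ω' (update ω a v) := by
    intro ω' v
    rw [Finset.piecewise_insert, update_self, ← Finset.update_piecewise_of_notMem _ _ _ ha]
    congr 1
    exact s.piecewise_congr (fun i hi => update_of_ne (ne_of_mem_of_not_mem hi ha) _ _) fun _ _ => rfl
  have hm2 : Measurable fun p : (ι → X) × X => h (s.piecewise p.1 (update ω a p.2)) := by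
    refine hm.comp (measurable_pi_iff.2 fun i => ?_)
    by_cases his : i ∈ s
    · simp only [Finset.piecewise_eq_of_mem _ _ _ his]
      exact (measurable_pi_apply i).comp measurable_fst
    · simp only [Finset.piecewise_eq_of_notMem _ _ _ his]
      by_cases hia : i = a
      · subst hia
        simp only [update_self]
        exact measurable_snd
      · simp only [update_of_ne hia]
        exact measurable_const
  have hint2 : Integrable (fun p : (ι → X) × X => h (s.piecewise p.1 (update ω a p.2)))
      ((Measure.pi fun _ : ι => μ).prod μ) :=
    Integrable.mono' (integrable_const C) hm2.aestronglyMeasurable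
      (ae_of_all _ fun p => by rw [Real.norm_eq_abs]; exact hb _)
  calc coordAvg μ (insert a s) h ω
      = ∫ ω', ∫ v, h ((insert a s).piecewise (update ω' a v) ω) ∂μ
          ∂Measure.pi fun _ : ι => μ := by
        unfold coordAvg
        rw [integral_pi_eq_integral_integral_update' (fun _ : ι => μ) a huniv hint1]
        simp
    _ = ∫ ω', ∫ v, h (s.piecewise ω' (update ω a v)) ∂μ ∂Measure.pi fun _ : ι => μ := by
        simp only [hglue]
    _ = ∫ v, ∫ ω', h (s.piecewise ω' (update ω a v)) ∂(Measure.pi fun _ : ι => μ) ∂μ :=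
        integral_integral_swap hint2
    _ = ∫ v, coordAvg μ s h (update ω a v) ∂μ := rfl


/-! ## §2 The hypothesis holds for every reasonable proposal law -/

omit [Fintype ι] [MeasurableSpace X] in
/-- Blindness to the coordinates of a set is inherited by its subsets. [ours] -/
theorem blind_mono {α : Type*} {t u : Finset ι} (htu : t ⊆ u) {R : (ι → X) → α}
    (hR : ∀ ω ω', R (u.piecewise ω' ω) = R ω) (ω ω' : ι → X) : R (t.piecewise ω' ω) = R ω := by
  have e : u.piecewise ω' (t.piecewise ω' ω) = u.piecewise ω' ω :=
    Finset.piecewise_piecewise_of_subset_right htu _ _ _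
  rw [← hR (t.piecewise ω' ω) ω', e, hR]

/-- **(a) THE OWN CONDITIONAL OF A PROPOSAL DENSITY BOUNDED AWAY FROM `0` AND `∞` QUALIFIES**:
for measurable `Q` with `0 < c ≤ Q ≤ C` and `a ∉ s`, `q := A_s Q / A_{insert a s} Q` is measurable,
`0 ≤ q ≤ C/c`, normalised in `a`, and `A_s Q = q·A_{insert a s} Q`. [ours] -/
theorem condProposal_props (s : Finset ι) {a : ι} (ha : a ∉ s) {Q : (ι → X) → ℝ} (hQm : Measurable Q)
    {c C : ℝ} (hc : 0 < c) (hcQ : ∀ ω, c ≤ Q ω) (hQC : ∀ ω, Q ω ≤ C) :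
    Measurable (fun ω => coordAvg μ s Q ω / coordAvg μ (insert a s) Q ω)
      ∧ (∀ ω, 0 ≤ coordAvg μ s Q ω / coordAvg μ (insert a s) Q ω)
      ∧ (∀ ω, coordAvg μ s Q ω / coordAvg μ (insert a s) Q ω ≤ C / c)
      ∧ (∀ ω, ∫ v, coordAvg μ s Q (update ω a v) / coordAvg μ (insert a s) Q (update ω a v) ∂μ = 1)
      ∧ (∀ ω, coordAvg μ s Q ω =
          coordAvg μ s Q ω / coordAvg μ (insert a s) Q ω * coordAvg μ (insert a s) Q ω) := by
  have hQabs : ∀ ω, |Q ω| ≤ C := fun ω => by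
    rw [abs_of_nonneg (hc.le.trans (hcQ ω))]; exact hQC ω
  have hbnd : ∀ (t : Finset ι) (ω : ι → X), c ≤ coordAvg μ t Q ω ∧ coordAvg μ t Q ω ≤ C :=
    fun t ω => coordAvg_mem_Icc μ t hQm hcQ hQC ω
  have hpos : ∀ (t : Finset ι) (ω : ι → X), 0 < coordAvg μ t Q ω := fun t ω => hc.trans_le (hbnd t ω).1
  refine ⟨(measurable_coordAvg μ s hQm).div (measurable_coordAvg μ (insert a s) hQm),
    fun ω => div_nonneg (hpos s ω).le (hpos _ ω).le, fun ω => ?_, fun ω => ?_, fun ω => ?_⟩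
  · rw [div_le_div_iff₀ (hpos _ ω) hc]
    have hC0 : 0 ≤ C := (hc.le.trans (hcQ ω)).trans (hQC ω)
    calc coordAvg μ s Q ω * c ≤ C * c := mul_le_mul_of_nonneg_right (hbnd s ω).2 hc.le
      _ ≤ C * coordAvg μ (insert a s) Q ω := mul_le_mul_of_nonneg_left (hbnd _ ω).1 hC0
  · simp only [coordAvg_insert_update]
    rw [integral_div, ← coordAvg_insert_eq_integral_coordAvg_update μ ha hQm hQabs ω,
      div_self (hpos _ ω).ne']
  · rw [div_mul_cancel₀ _ (hpos _ ω).ne']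

/-- **(b) AUTOREGRESSIVE PRODUCTS QUALIFY.**  `Q = R·q·T` with `R` blind to the coordinates of
`insert a s` (the conditionals of the coordinates generated before `a`), `q` blind to `s` and
normalised in `a` (the conditional at `a`), `A_s T = 1` (the later conditionals integrate to one), all
bounded measurable, `a ∉ s`: then `A_s Q = R·q`, `A_{insert a s} Q = R`, hence
`A_s Q = q·A_{insert a s} Q`. [ours] -/
theorem coordAvg_arProduct (s : Finset ι) {a : ι} (ha : a ∉ s) {R q T : (ι → X) → ℝ}
    (hRm : Measurable R) {CR : ℝ} (hRb : ∀ ω, |R ω| ≤ CR)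
    (hRs : ∀ ω ω', R ((insert a s).piecewise ω' ω) = R ω)
    (hqm : Measurable q) {Cq : ℝ} (hqb : ∀ ω, |q ω| ≤ Cq) (hqs : ∀ ω ω', q (s.piecewise ω' ω) = q ω)
    (hq1 : ∀ ω, ∫ v, q (update ω a v) ∂μ = 1)
    (hTm : Measurable T) {CT : ℝ} (hTb : ∀ ω, |T ω| ≤ CT) (hT1 : ∀ ω, coordAvg μ s T ω = 1) :
    (∀ ω, coordAvg μ s (fun η => R η * q η * T η) ω = R ω * q ω)
      ∧ (∀ ω, coordAvg μ (insert a s) (fun η => R η * q η * T η) ω = R ω)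
      ∧ (∀ ω, coordAvg μ s (fun η => R η * q η * T η) ω =
          q ω * coordAvg μ (insert a s) (fun η => R η * q η * T η) ω) := by
  have hRs' : ∀ ω ω', R (s.piecewise ω' ω) = R ω :=
    blind_mono (Finset.subset_insert a s) hRs
  have hRa : ∀ ω ω', R (({a} : Finset ι).piecewise ω' ω) = R ω :=
    blind_mono (Finset.singleton_subset_iff.2 (Finset.mem_insert_self a s)) hRs
  -- `A_s (R q T) = R q · A_s T = R q`
  have hS : ∀ ω, coordAvg μ s (fun η => R η * q η * T η) ω = R ω * q ω := by
    intro ω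
    rw [coordAvg_mul_left μ s (Φ := fun η => R η * q η) (H := T)
      (fun ω ω' => by simp only [hRs', hqs]) ω, hT1 ω, mul_one]
  -- the tower `A_{insert a s} = A_a ∘ A_s`, then `A_a (R q) = R · A_a q = R`
  have hPm : Measurable fun η => R η * q η * T η := (hRm.mul hqm).mul hTm
  have hPb : ∀ ω, |R ω * q ω * T ω| ≤ CR * Cq * CT := fun ω => by
    rw [abs_mul, abs_mul]
    have h1 : |R ω| * |q ω| ≤ CR * Cq :=
      mul_le_mul (hRb ω) (hqb ω) (abs_nonneg _) ((abs_nonneg _).trans (hRb ω))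
    exact mul_le_mul h1 (hTb ω) (abs_nonneg _)
      ((mul_nonneg (abs_nonneg _) (abs_nonneg _)).trans h1)
  have hI : ∀ ω, coordAvg μ (insert a s) (fun η => R η * q η * T η) ω = R ω := by
    intro ω
    rw [coordAvg_insert_eq_integral_coordAvg_update μ ha hPm hPb ω]
    have hRu : ∀ v, R (update ω a v) = R ω := fun v => by
      have e := hRa ω (update ω a v)
      rwa [Finset.piecewise_singleton, update_self] at e
    simp only [hS, hRu]
    rw [integral_const_mul, hq1 ω, mul_one]
  exact ⟨hS, hI, fun ω => by rw [hS ω, hI ω, mul_comm]⟩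

/-! ## §3 Packaged acceptance ceilings -/

/-- **ACCEPTANCE CEILING FOR AN AUTOREGRESSIVE PROPOSAL** (`Q = R·q·T` as in `coordAvg_arProduct`, a
probability density; target `F ≥ 0` bounded measurable with `Z > 0`):
`ā ≤ 1 − (1/(4Z)) ∫ |A_s F − q·A_{insert a s} F| dπ` — the conditional `q` used at the coordinate `a`
alone caps the equilibrium acceptance of the exact sampler. [ours] -/
theorem meanAccept_le_of_arProduct (s : Finset ι) {a : ι} (ha : a ∉ s) {F R q T : (ι → X) → ℝ}
    (hFm : Measurable F) (hF0 : ∀ ω, 0 ≤ F ω) {CF : ℝ} (hFb : ∀ ω, F ω ≤ CF)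
    (hZ : 0 < ∫ ω, F ω ∂Measure.pi (fun _ : ι => μ))
    (hRm : Measurable R) (hR0 : ∀ ω, 0 ≤ R ω) {CR : ℝ} (hRb : ∀ ω, R ω ≤ CR)
    (hRs : ∀ ω ω', R ((insert a s).piecewise ω' ω) = R ω)
    (hqm : Measurable q) (hq0 : ∀ ω, 0 ≤ q ω) {Cq : ℝ} (hqb : ∀ ω, q ω ≤ Cq)
    (hqs : ∀ ω ω', q (s.piecewise ω' ω) = q ω) (hq1 : ∀ ω, ∫ v, q (update ω a v) ∂μ = 1)
    (hTm : Measurable T) (hT0 : ∀ ω, 0 ≤ T ω) {CT : ℝ} (hTb : ∀ ω, T ω ≤ CT)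
    (hT1 : ∀ ω, coordAvg μ s T ω = 1)
    (hQ1 : ∫ ω, R ω * q ω * T ω ∂Measure.pi (fun _ : ι => μ) = 1) :
    ∫ x, ∫ y, min (F x / (∫ ω, F ω ∂Measure.pi (fun _ : ι => μ)) * (R y * q y * T y))
        (F y / (∫ ω, F ω ∂Measure.pi (fun _ : ι => μ)) * (R x * q x * T x))
        ∂Measure.pi (fun _ : ι => μ) ∂Measure.pi (fun _ : ι => μ)
      ≤ 1 - 1 / (4 * ∫ ω, F ω ∂Measure.pi (fun _ : ι => μ)) *
          ∫ ω, |coordAvg μ s F ω - q ω * coordAvg μ (insert a s) F ω| ∂Measure.pi (fun _ : ι => μ) := by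
  have hRabs : ∀ ω, |R ω| ≤ CR := fun ω => by rw [abs_of_nonneg (hR0 ω)]; exact hRb ω
  have hqabs : ∀ ω, |q ω| ≤ Cq := fun ω => by rw [abs_of_nonneg (hq0 ω)]; exact hqb ω
  have hTabs : ∀ ω, |T ω| ≤ CT := fun ω => by rw [abs_of_nonneg (hT0 ω)]; exact hTb ω
  obtain ⟨_, _, hfac⟩ := coordAvg_arProduct μ s ha hRm hRabs hRs hqm hqabs hqs hq1 hTm hTabs hT1
  have hQm : Measurable fun η => R η * q η * T η := (hRm.mul hqm).mul hTm
  have hQ0 : ∀ ω, 0 ≤ R ω * q ω * T ω := fun ω => mul_nonneg (mul_nonneg (hR0 ω) (hq0 ω)) (hT0 ω)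
  have hQb : ∀ ω, R ω * q ω * T ω ≤ CR * Cq * CT := fun ω => by
    have h1 : R ω * q ω ≤ CR * Cq := mul_le_mul (hRb ω) (hqb ω) (hq0 ω) ((hR0 ω).trans (hRb ω))
    exact mul_le_mul h1 (hTb ω) (hT0 ω) ((mul_nonneg (hR0 ω) (hq0 ω)).trans h1)
  exact meanAccept_le_of_condProposal μ s hFm hF0 hFb hZ hQm hQ0 hQb hQ1 hqm hq0 hqb hq1 hfac

/-- **ACCEPTANCE CEILING FOR ANY PROPOSAL DENSITY BOUNDED AWAY FROM `0` AND `∞`** (`0 < c ≤ Q ≤ C`,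
`∫ Q dπ = 1`; target `F ≥ 0` bounded measurable, `Z > 0`; `a ∉ s`): with the proposal's own conditional
`q = A_s Q / A_{insert a s} Q` at `a`,
`ā ≤ 1 − (1/(4Z)) ∫ |A_s F − q·A_{insert a s} F| dπ`. [ours] -/
theorem meanAccept_le_of_pos_proposal (s : Finset ι) {a : ι} (ha : a ∉ s) {F Q : (ι → X) → ℝ}
    (hFm : Measurable F) (hF0 : ∀ ω, 0 ≤ F ω) {CF : ℝ} (hFb : ∀ ω, F ω ≤ CF)
    (hZ : 0 < ∫ ω, F ω ∂Measure.pi (fun _ : ι => μ))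
    (hQm : Measurable Q) {c C : ℝ} (hc : 0 < c) (hcQ : ∀ ω, c ≤ Q ω) (hQC : ∀ ω, Q ω ≤ C)
    (hQ1 : ∫ ω, Q ω ∂Measure.pi (fun _ : ι => μ) = 1) :
    ∫ x, ∫ y, min (F x / (∫ ω, F ω ∂Measure.pi (fun _ : ι => μ)) * Q y)
        (F y / (∫ ω, F ω ∂Measure.pi (fun _ : ι => μ)) * Q x)
        ∂Measure.pi (fun _ : ι => μ) ∂Measure.pi (fun _ : ι => μ)
      ≤ 1 - 1 / (4 * ∫ ω, F ω ∂Measure.pi (fun _ : ι => μ)) *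
          ∫ ω, |coordAvg μ s F ω - coordAvg μ s Q ω / coordAvg μ (insert a s) Q ω *
            coordAvg μ (insert a s) F ω| ∂Measure.pi (fun _ : ι => μ) := by
  obtain ⟨hqm, hq0, hqb, hq1, hfac⟩ := condProposal_props μ s ha hQm hc hcQ hQC
  exact meanAccept_le_of_condProposal μ s hFm hF0 hFb hZ hQm (fun ω => hc.le.trans (hcQ ω)) hQC hQ1
    hqm hq0 hqb hq1 hfac

end Summit.Ventures.LatticeQCDFlow.Theory2.Autoregressive

end
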